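import Summits.BirchSwinnertonDyer.Rank1Residual.X11b.AnticyclotomicControlLocallyTrivialClass
import Summits.BirchSwinnertonDyer.Rank1Residual.X11b.LocalTorsionMultiplicative
import Literature.NumberTheory.EllipticCurves.ComplexMultiplicationCoatesWilesSeparationProofs
import HarnessLib

/-!
# X11b, route R1 — `E(ℚ_ℓ)[p] = 0` for `ℓ ≠ p` from `p ∤ c_ℓ(E)·#Ẽ_ns(𝔽_ℓ)`: the locally-trivial side
# condition `LocallyTrivialAt W p` is a NUMERIC criterion (the test of census3)

HONEST FRAMING (cell `b2b-bsdres`, run/shared/lean/b2b/bsd-rank1-residual/, verbatim in every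
file): the goal of the cell is to DELETE the COMBINATION-SHAPED residual classes of the
Birch–Swinnerton-Dyer formula for ALL analytic-rank `≤ 1` elliptic curves over `ℚ` — "full BSD
formula for every rank `≤ 1` curve in class `C`" assembled STRICTLY from published theorems — so
that the rank-`≤ 1` remainder becomes exactly the CONSTRUCTION-SHAPED classes, which are TYPED
(missing-input `Prop`s), NOT attempted. This is not "finishing BSD". Sub-cell
`b2b-bsdres-multr1-p1` (X11b, route R1 = Castella 2018 Thm. A re-proved along the author's
erratum); a RESEARCH ROUTE; no claim beyond the stated class; X11b stays CONSTRUCTION-SHAPED;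
nothing here changes a label; no named fact is minted (theorems only; no `sorry`).

## What this file proves

The side condition `LocallyTrivialAt W p` of `AnticyclotomicControlLocallyTrivialClass` (under
which Cas18 Thm. 2.3 on route R1 is the two Poitou–Tate atoms (P6) ∧ (L10)) asks, at every bad
`ℓ ≠ p`, for `E(ℚ_ℓ)[p] = 0` and `p ∤ c_ℓ(E)`. Here the first clause is derived from the local
filtration at `ℓ` (Silverman *AEC* VII.2.1, VII.2.2, IV.2.3: `[E(ℚ_ℓ) : E₁(ℚ_ℓ)] = c_ℓ · #Ẽ_ns(𝔽_ℓ)`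
and `[p]` is an isometry of the parameter on `E₁(ℚ_ℓ)` for `ℓ ∤ p`), so that the whole side
condition becomes the numeric test `p ∤ c_ℓ(E) · #Ẽ_ns(𝔽_ℓ)` of the unit's census (census3; on the
`ChainLocus` pairs below `5·10⁵`: 1 198 650 of 1 357 341):

* `LocalTorsion.eq_zero_of_isInReductionKernel_of_prime_nsmul` — **`E₁(ℚ_ℓ)[p] = 0` for primes
  `p ≠ ℓ`**: for a `ℤ_ℓ`-integral equation, a point of the kernel of reduction killed by `p` is `O`
  (`‖z(pQ)‖ = ‖z(Q)‖`, tree `norm_formalParameter_nsmul_of_not_dvd`);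
* `LocalTorsion.padicTorsion_eq_zero_of_not_dvd_index` — `p ∤ [E(ℚ_ℓ):E₁(ℚ_ℓ)] ⟹ E(ℚ_ℓ)[p] = 0`;
* `LocalTorsion.index_formalFiltration_one_eq` — `[E(ℚ_ℓ):E₁(ℚ_ℓ)] = c_ℓ · N_ℓ` with
  `N_ℓ = reductionPointCount W ℓ = #Ẽ_ns(𝔽_ℓ)` (tree `index_formalFiltration`), and the transfer of
  `c_ℓ` to the place of `ℚ` at `ℓ` (`localTamagawaNumber_padic_eq_holds`);
* **`LocalTorsion.padicTorsion_eq_zero_of_not_dvd`** — `ℓ ≠ p`, `p ∤ c_ℓ(E)·N_ℓ ⟹ E(ℚ_ℓ)[p] = 0`;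
* **`locallyTrivialAt_of_not_dvd`** — `(∀ ℓ ∣ N_E, ℓ ≠ p: p ∤ c_ℓ(E)·N_ℓ) ⟹ LocallyTrivialAt W p`,
  hence (`r1ControlOnTreeAt_of_two_atoms`) `R1TwoAtomsAt W p → R1ControlOnTreeAt W p` under that
  numeric test (`r1ControlOnTreeAt_of_two_atoms_of_not_dvd`).

References: [SilvermanAEC2009] VII.2.1, VII.2.2, VII.3.1, IV.2.3, IV.3.2; [GreenbergLNM1716] §3
pp. 74–75; [JetchevSkinnerWan2017] Prop. 3.3.4 (arXiv:1512.06894 pp. 12–13).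
-/

noncomputable section

open scoped Classical

open WeierstrassCurve NumberField IsDedekindDomain Field
open Literature.NumberTheory.EllipticCurves Literature.NumberTheory.EllipticCurves.Rank1Residual
open Summit.BirchSwinnertonDyer.BirchSwinnertonDyer.Theorems

namespace Summit.BirchSwinnertonDyer.Rank1Residual.X11b

namespace LocalTorsion

section Padic

variable {ℓ : ℕ} [Fact ℓ.Prime] (V : WeierstrassCurve ℚ_[ℓ]) [V.IsIntegral ℤ_[ℓ]] [V.IsElliptic]

/-- **`E₁(ℚ_ℓ)[p] = 0` for a prime `p ≠ ℓ`** (Silverman, *AEC* IV.2.3(a)/IV.3.2(b) with VII.2.2: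
`[p](T) = pT + O(T²)` with `p ∈ ℤ_ℓ^×`, so `‖z(pQ)‖ = ‖z(Q)‖`; tree
`norm_formalParameter_nsmul_of_not_dvd`): a point of the kernel of reduction of an `ℓ`-integral
equation killed by `p` is `O`. [cite: SilvermanAEC2009, Prop. IV.3.2(b) and VII.2.2] -/
theorem eq_zero_of_isInReductionKernel_of_prime_nsmul {p : ℕ} (hp : p.Prime) (hℓp : ℓ ≠ p)
    {Q : V.toAffine.Point} (hQ : V.IsInReductionKernel Q) (hpQ : p • Q = 0) : Q = 0 := by
  have hnd : ¬ ℓ ∣ p := fun h ↦ hℓp ((Nat.prime_dvd_prime_iff_eq Fact.out hp).mp h)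
  have hnorm := V.norm_formalParameter_nsmul_of_not_dvd hnd hQ
  rw [hpQ, V.formalParameter_zero, norm_zero] at hnorm
  exact (V.formalParameter_eq_zero_iff hQ).mp (norm_eq_zero.mp hnorm.symm)

end Padic

section Rat

variable (W : WeierstrassCurve ℚ) [W.IsElliptic] [W.IsGloballyMinimal] (ℓ p : ℕ) [Fact ℓ.Prime]
  [hp : Fact p.Prime]

/-- **`p ∤ [E(ℚ_ℓ) : E₁(ℚ_ℓ)] ⟹ E(ℚ_ℓ)[p] = 0`** for `ℓ ≠ p` (with `m = [E(ℚ_ℓ):E₁(ℚ_ℓ)]`: `m • P`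
lies in `E₁(ℚ_ℓ)` and is killed by `p`, hence is `O`; `P` is killed by `p` and `m`, `gcd = 1`).
[cite: SilvermanAEC2009, VII.2 Prop. 2.1, VII.3 Prop. 3.1] -/
theorem padicTorsion_eq_zero_of_not_dvd_index (hℓp : ℓ ≠ p)
    (hidx : ¬ p ∣ ((W.baseChange ℚ_[ℓ]).formalFiltration 1).index)
    (P : (W.baseChange ℚ_[ℓ]).toAffine.Point) (hP : p • P = 0) : P = 0 := by
  set m : ℕ := ((W.baseChange ℚ_[ℓ]).formalFiltration 1).index with hm
  have hmem : m • P ∈ (W.baseChange ℚ_[ℓ]).formalFiltration 1 := AddSubgroup.nsmul_index_mem _ P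
  have hkill : p • (m • P) = 0 := by rw [smul_comm, hP, nsmul_zero]
  have hmP : m • P = 0 :=
    eq_zero_of_isInReductionKernel_of_prime_nsmul (W.baseChange ℚ_[ℓ]) hp.out hℓp hmem.1 hkill
  exact stubC_eq_zero_of_zsmul_of_nsmul hp.out hidx P (by rw [natCast_zsmul]; exact hP) hmP

/-- **`[E(ℚ_ℓ) : E₁(ℚ_ℓ)] = c_ℓ(E) · N_ℓ`**, `N_ℓ = reductionPointCount W ℓ` (`= #Ẽ_ns(𝔽_ℓ)`: `ℓ − 1`,
`ℓ + 1`, `ℓ` at a split, non-split, additive `ℓ`), the Tamagawa number read at the place of `ℚ` at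
`ℓ` (`index_formalFiltration`, `localTamagawaNumber_padic_eq_holds`). [cite: SilvermanAEC2009, VII.2 Prop. 2.1 and VII.6.1] -/
theorem index_formalFiltration_one_eq :
    ((W.baseChange ℚ_[ℓ]).formalFiltration 1).index =
      (W.baseChange ((ratPlace ℓ).adicCompletion ℚ)).localTamagawaNumber
        ((ratPlace ℓ).adicCompletionIntegers ℚ) * reductionPointCount W ℓ := by
  haveI : (W.baseChange ℚ_[ℓ]).IsMinimal ℤ_[ℓ] := isMinimal_map_padic_of_isGloballyMinimal W ℓ
  rw [index_formalFiltration (W.baseChange ℚ_[ℓ]) (le_refl 1), pow_zero, mul_one,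
    natCard_point_reduction_baseChange_padic,
    localTamagawaNumber_padic_eq_holds W (ratPlace ℓ) ℓ (primesEquiv_ratPlace ℓ)]

/-- **`E(ℚ_ℓ)[p] = 0` from the numeric test `p ∤ c_ℓ(E) · N_ℓ`** (`ℓ ≠ p`). This is the exact test
`p ∤ c_ℓ·(ℓ − a_ℓ)` of the unit's census3 at a bad `ℓ`. [cite: SilvermanAEC2009, VII.2 Prop. 2.1, VII.3 Prop. 3.1] -/
theorem padicTorsion_eq_zero_of_not_dvd (hℓp : ℓ ≠ p)
    (h : ¬ p ∣ (W.baseChange ((ratPlace ℓ).adicCompletion ℚ)).localTamagawaNumber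
        ((ratPlace ℓ).adicCompletionIntegers ℚ) * reductionPointCount W ℓ)
    (P : (W.baseChange ℚ_[ℓ]).toAffine.Point) (hP : p • P = 0) : P = 0 :=
  padicTorsion_eq_zero_of_not_dvd_index W ℓ p hℓp (by rwa [index_formalFiltration_one_eq W ℓ]) P hP

end Rat

end LocalTorsion

/-! ## `LocallyTrivialAt` from the numeric test -/

section Criterion

variable (W : WeierstrassCurve ℚ) [W.IsElliptic] [W.IsGloballyMinimal] (p : ℕ) [Fact p.Prime]

/-- **`LocallyTrivialAt W p` from `p ∤ c_ℓ(E)·N_ℓ` at every bad `ℓ ≠ p`** (`N_ℓ = reductionPointCount W ℓ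
= #Ẽ_ns(𝔽_ℓ)`): the locally-trivial side condition is the numeric test of census3.
[cite: SilvermanAEC2009, VII.2 Prop. 2.1, VII.3 Prop. 3.1] [cite: GreenbergLNM1716, §3 pp. 74–75] -/
theorem locallyTrivialAt_of_not_dvd
    (h : ∀ (ℓ : ℕ) [Fact ℓ.Prime], ℓ ∣ W.conductorNorm ℤ → ℓ ≠ p →
      ¬ p ∣ (W.baseChange ((ratPlace ℓ).adicCompletion ℚ)).localTamagawaNumber
          ((ratPlace ℓ).adicCompletionIntegers ℚ) * reductionPointCount W ℓ) :
    LocallyTrivialAt W p := by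
  intro ℓ _ hN hℓp
  have hℓ := h ℓ hN hℓp
  refine ⟨LocalTorsion.padicTorsion_eq_zero_of_not_dvd W ℓ p hℓp hℓ, fun hc ↦ hℓ ?_⟩
  exact Dvd.dvd.mul_right hc _

/-- **(CTL) on route R1 from two atoms under the numeric test**: if `p ∤ c_ℓ(E)·N_ℓ` at every bad
`ℓ ≠ p`, then `R1TwoAtomsAt W p → R1ControlOnTreeAt W p` (Cas18 Thm. 2.3 at every datum = JSW17
Prop. 3.2.1/(7.1.5) ∧ Lemma 3.3.3). [cite: Castella2018, Thm. 2.3 (arXiv:1704.06608 p. 5)] [cite: JetchevSkinnerWan2017, Thm. 3.3.1, Prop. 3.2.1, Lemma 3.3.3 (arXiv:1512.06894 pp. 10–12)] -/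
theorem r1ControlOnTreeAt_of_two_atoms_of_not_dvd
    (h : ∀ (ℓ : ℕ) [Fact ℓ.Prime], ℓ ∣ W.conductorNorm ℤ → ℓ ≠ p →
      ¬ p ∣ (W.baseChange ((ratPlace ℓ).adicCompletion ℚ)).localTamagawaNumber
          ((ratPlace ℓ).adicCompletionIntegers ℚ) * reductionPointCount W ℓ)
    (hTA : R1TwoAtomsAt W p) : R1ControlOnTreeAt W p :=
  r1ControlOnTreeAt_of_two_atoms W p (locallyTrivialAt_of_not_dvd W p h) hTA

end Criterion

end Summit.BirchSwinnertonDyer.Rank1Residual.X11b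

end
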